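import Summits.QuantumFields.YangMills.Theorems.FluctuationComparisonRegPrIntLS2BetaCentralFaceDiscrepancy
import HarnessLib

/-!
# S2β · c₃ — THE CENTRAL FACE LETTER `hC` OF px5 g23's Q11i FROM THREE NAMED LETTERS: `sC := ρκ + 2·aκ·(((L−1)∕2 + 1)·mR)`
# (relative correction factor `ρκ`, absolute correction factor `aκ`, relative lift chord at the central bond `mR`)

Cell `ym3-torus` (YM ladder rung R3 = continuum `SU(2)` Yang–Mills on the three-torus at fixed lattice data — a RUNG: NOT d = 4, NOT infinite volume,
NOT a mass gap, NOT Clay).  Width seat «width 20» `ym3-torus-px20` (gen 24), FREE px helper on crux `stmt-QuantumFields-20520`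
(`…Theses.UnitScaleTilt.FluctuationComparisonRegPrIntL`), LINE g18-1 S2β, the (ST) sup chain; c₃ ASSEMBLER (ARCHITECT RULINGS px17 g22 19:24:49Z (i), 19:37:59Z (1)).
THE DOCK: px5 g23's per-`B` one-profile row ✓p833084 `…LiftLadderPerBlockRow.sq_pi_norm_trunc_le_perBlock` takes the face discrepancy letter `hface`; his Q11i
✓∕⧗`…FaceDiscrepancyStage.hface_of_central` reduces `hface` to the CENTRAL letter `hC : ∀ b ∈ pS face-crossing, dist1 (R⁻¹η at the central bond of the face of
⟨blockOf b₋, dir b⟩) ≤ sC` (central bond in the `transl (emb B) (((L−1)∕2)·e_μ)` spelling) plus the `ρ̃` ladder; THIS FILE discharges `hC` by name from px20's ✓p833628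
`dist1_centralDisc_le_stage` and three letters read on `pS`: the RELATIVE (0.4) correction factor `dist1 (κ_W·κ_{W₁}⁻¹) ≤ ρκ` ((O3-LOC) ✓p831296's object — c₁'s curl
currency), the ABSOLUTE correction factor `dist1 κ_{W₁} ≤ aκ` (small-field class, lit `LoopAverage` (0.5)–(0.7)), and the relative lift chord at the central bond `≤ mR`
(`E′`∕arc currency, ✓p832421 `norm_logVec_liftChord_le_eleven_tenths`): **`sC := ρκ + 2·aκ·(((L−1)∕2 + 1)·mR)`**.
`--kind proof --supports stmt-QuantumFields-20520 --as helper`, count-neutral, DEFINITION-FREE (0 `def`, 0 `instance`, 0 `notation`, 0 `sorry`, default heartbeats);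
`SU(2)`, generic `P : Params`, levels `j∕j+1`, standing range, any `LoopAverage ℰ` (the tower's averaging = `blockAvg ℰ`); the `AxStage` clause texts `hwt`∕`hlift`∕(T4)×2∕(T5)×2
as in ✓`axStage_exists`; `hcomm` the `SU(2)` commutator letter.

WHAT IS PROVED (sorry-free).
* `centralBond_eq_b0` — `⟨transl (emb B) (((L−1)∕2)·e_μ), μ⟩ = b0 ⟨B, μ⟩` (lit ✓`b0_eq_shiftN_emb` + ✓p831574 `shiftN_emb_eq_transl`): px5's central bond IS print's `b₀`.
* ★★★`central_hC_of_letters` — `hC` of ✓∕⧗`hface_of_central` VERBATIM (conclusion text = his binder, `sC := ρκ + 2·aκ·(((L−1)∕2 + 1)·mR)`) from `hκrel`, `hκabs`, `hR` on `pS`.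

INHABITATION (★★OWNER RULING №100): LAW-FREE; the three letters are the c₁-currency κ-ratio (px16∕px13's budget), the small-field correction-factor bound, and the lift row.

HONEST SCOPE.  Group algebra + lattice bookkeeping over landed letters by name; nothing of Bałaban's renormalisation-group analysis is asserted or proved ([Balaban1987RG1] (0.4) p.253;
[Balaban1985Averaging] (19)–(20) p.21; [Balaban1985RegularSpaces] (1.19) p.79, (1.29) p.81); `ρκ`∕`aκ`∕`mR`, the arc profile, (TOP-LAD′), the budgets (SCT′), (ST″)∕(ST′)∕(ST),
LOC″∕LOC are HYPOTHESES ∕ other files; GAP♯∘ (`stub_uniformFibreGapOrbit`, registry 3732b7df UNTOUCHED), the five registered stubs (0∕5), S2β, 20520, 19936, 19200,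
`YM3TorusSU2` are NOT proved; no registered stub is closed; rung R3 — NOT d = 4, NOT infinite volume, NOT a mass gap, NOT Clay; the Yang–Mills mass gap is NOT proved.
-/

set_option autoImplicit false

namespace Summit.QuantumFields.YangMills.Theorems.FluctuationComparisonRegPrIntLS2BetaCentralFaceDiscrepancyDock

open Literature.MathematicalPhysics.QuantumLattice (su2Quat)
open Literature.MathematicalPhysics.QuantumFieldTheory.Balaban1983to89
open T4Continuum BlockAveraging AveragingRT B10Eq47AxialChi
open B10Eq27TorusAxialLog (rel axialT transl)
open T4CubeChartGnomonic (SU2)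
open T4HaarSU2ExpChart (expPoint)
open T4ExpWindowSmallField (logVec)
open B12SmallFieldDomain259 (b0)
open Summit.QuantumFields.YangMills.Theorems.FluctuationComparisonRegPrIntLS2BetaCentralLineTreeComb (shiftN_emb_eq_transl)
open Summit.QuantumFields.YangMills.Theorems.FluctuationComparisonRegPrIntLS2BetaCentralFaceDiscrepancy (dist1_centralDisc_le_stage)

variable {P : Params}

/-- The central face bond of the coarse bond `⟨B, μ⟩` in px5 g23's `transl` spelling IS `b₀` (lit ✓`b0_eq_shiftN_emb` + ✓p831574 `shiftN_emb_eq_transl`). [cite: Balaban1987RG1, p.267] -/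
theorem centralBond_eq_b0 {j : ℕ} (B : Site P (j + 1)) (μ : Fin P.d) :
    (⟨transl (emb B) (fun ν => if ν = μ then (((P.L - 1) / 2 : ℕ) : ℤ) else 0), μ⟩ : PBond P j) = b0 ⟨B, μ⟩ := by
  rw [B12B0LoopGeometry267.b0_eq_shiftN_emb, shiftN_emb_eq_transl]

/-- ★★★ **THE CENTRAL FACE LETTER `hC` OF px5 g23's `hface_of_central` (Q11i) FROM THREE NAMED LETTERS.**  For the two `AxStage` stage towers at level `j` (hat weights, hat lift,
(T4)×2, (T5)×2 with the tower's averaging `blockAvg ℰ`) and the `SU(2)` commutator letter: if on the bond set `pS` (read at its face-crossing bonds `b`, coarse bond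
`c_b := ⟨blockOf b₋, dir b⟩`) the RELATIVE correction factor is `≤ ρκ` (`hκrel` — (O3-LOC)'s object, c₁'s curl currency), the second tower's correction factor is `≤ aκ`
(`hκabs` — the small-field class letter) and the relative lift chord at the central bond is `≤ mR` (`hR` — `E′`∕arc currency), then px5's `hC` holds with
**`sC := ρκ + 2·aκ·(((L−1)∕2 + 1)·mR)`** (✓p833628 `dist1_centralDisc_le_stage` at `c_b`, `b₀(c_b)` = the `transl` central bond by ✓`centralBond_eq_b0`).
[cite: Balaban1987RG1, (0.4) p.253; Balaban1985Averaging, (19)-(20) p.21; Balaban1985RegularSpaces, (1.19) p.79, (1.29) p.81] -/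
theorem central_hC_of_letters (ℰ : LoopAverage SU2) {j : ℕ} (hj : j + 1 ≤ P.m + P.K)
    (wt : (i : ℕ) → PBond P i → PBond P (i + 1) → ℝ) (lift : (i : ℕ) → GaugeField P (i + 1) SU2 → GaugeField P i SU2)
    (g g₀ : (i : ℕ) → Site P i → SU2) (U U₁ : GaugeField P 0 SU2)
    (hwt : ∀ b e, wt j b e = if e.dir = b.dir ∧ (b.src b.dir - emb e.src b.dir).val < P.L then
      ∏ ν ∈ Finset.univ.erase b.dir, max 0 (1 - ((rel (emb e.src) b.src ν).natAbs : ℝ) / P.L) else 0)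
    (hlift : ∀ (X : GaugeField P (j + 1) SU2) (b : PBond P j), lift j X b = expPoint (∑ e, wt j b e • ((P.L : ℝ)⁻¹ • logVec (su2Quat (X e)))))
    (hT4 : ∀ x, axialT (GaugeField.gaugeAct (g j) (Averaging.iter (fun i => blockAvg (P := P) (j := i) ℰ) j U)) (emb (blockOf x)) x =
      axialT (lift j (GaugeField.gaugeAct (g (j + 1)) (Averaging.iter (fun i => blockAvg (P := P) (j := i) ℰ) (j + 1) U))) (emb (blockOf x)) x)
    (hT4' : ∀ x, axialT (GaugeField.gaugeAct (g₀ j) (Averaging.iter (fun i => blockAvg (P := P) (j := i) ℰ) j U₁)) (emb (blockOf x)) x =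
      axialT (lift j (GaugeField.gaugeAct (g₀ (j + 1)) (Averaging.iter (fun i => blockAvg (P := P) (j := i) ℰ) (j + 1) U₁))) (emb (blockOf x)) x)
    (hT5 : (blockAvg (P := P) (j := j) ℰ).avg (GaugeField.gaugeAct (g j) (Averaging.iter (fun i => blockAvg (P := P) (j := i) ℰ) j U)) =
      GaugeField.gaugeAct (g (j + 1)) (Averaging.iter (fun i => blockAvg (P := P) (j := i) ℰ) (j + 1) U))
    (hT5' : (blockAvg (P := P) (j := j) ℰ).avg (GaugeField.gaugeAct (g₀ j) (Averaging.iter (fun i => blockAvg (P := P) (j := i) ℰ) j U₁)) =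
      GaugeField.gaugeAct (g₀ (j + 1)) (Averaging.iter (fun i => blockAvg (P := P) (j := i) ℰ) (j + 1) U₁))
    (hcomm : ∀ x y : SU2, dist1 (x * y * x⁻¹ * y⁻¹) ≤ 2 * dist1 x * dist1 y)
    (pS : PBond P j → Prop) {ρκ aκ mR : ℝ} (hmR : 0 ≤ mR)
    (hκrel : ∀ b : PBond P j, pS b → blockOf (b.src.shift b.dir) ≠ blockOf b.src →
      dist1 (corr ℰ (GaugeField.gaugeAct (g j) (Averaging.iter (fun i => blockAvg (P := P) (j := i) ℰ) j U)) ⟨blockOf b.src, b.dir⟩ *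
        (corr ℰ (GaugeField.gaugeAct (g₀ j) (Averaging.iter (fun i => blockAvg (P := P) (j := i) ℰ) j U₁)) ⟨blockOf b.src, b.dir⟩)⁻¹) ≤ ρκ)
    (hκabs : ∀ b : PBond P j, pS b → blockOf (b.src.shift b.dir) ≠ blockOf b.src →
      dist1 (corr ℰ (GaugeField.gaugeAct (g₀ j) (Averaging.iter (fun i => blockAvg (P := P) (j := i) ℰ) j U₁)) ⟨blockOf b.src, b.dir⟩) ≤ aκ)
    (hR : ∀ b : PBond P j, pS b → blockOf (b.src.shift b.dir) ≠ blockOf b.src →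
      dist1 (lift j (GaugeField.gaugeAct (g (j + 1)) (Averaging.iter (fun i => blockAvg (P := P) (j := i) ℰ) (j + 1) U))
            ⟨transl (emb (blockOf b.src)) (fun ν => if ν = b.dir then (((P.L - 1) / 2 : ℕ) : ℤ) else 0), b.dir⟩ *
          (lift j (GaugeField.gaugeAct (g₀ (j + 1)) (Averaging.iter (fun i => blockAvg (P := P) (j := i) ℰ) (j + 1) U₁))
            ⟨transl (emb (blockOf b.src)) (fun ν => if ν = b.dir then (((P.L - 1) / 2 : ℕ) : ℤ) else 0), b.dir⟩)⁻¹) ≤ mR) :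
    ∀ b : PBond P j, pS b → blockOf (b.src.shift b.dir) ≠ blockOf b.src →
      dist1 ((lift j (GaugeField.gaugeAct (g (j + 1)) (Averaging.iter (fun i => blockAvg (P := P) (j := i) ℰ) (j + 1) U))
              ⟨transl (emb (blockOf b.src)) (fun ν => if ν = b.dir then (((P.L - 1) / 2 : ℕ) : ℤ) else 0), b.dir⟩ *
            (lift j (GaugeField.gaugeAct (g₀ (j + 1)) (Averaging.iter (fun i => blockAvg (P := P) (j := i) ℰ) (j + 1) U₁))
              ⟨transl (emb (blockOf b.src)) (fun ν => if ν = b.dir then (((P.L - 1) / 2 : ℕ) : ℤ) else 0), b.dir⟩)⁻¹)⁻¹ *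
        (GaugeField.gaugeAct (g j) (Averaging.iter (fun i => blockAvg (P := P) (j := i) ℰ) j U)
            ⟨transl (emb (blockOf b.src)) (fun ν => if ν = b.dir then (((P.L - 1) / 2 : ℕ) : ℤ) else 0), b.dir⟩ *
          (GaugeField.gaugeAct (g₀ j) (Averaging.iter (fun i => blockAvg (P := P) (j := i) ℰ) j U₁)
            ⟨transl (emb (blockOf b.src)) (fun ν => if ν = b.dir then (((P.L - 1) / 2 : ℕ) : ℤ) else 0), b.dir⟩)⁻¹)) ≤
        ρκ + 2 * aκ * ((((P.L - 1) / 2 + 1 : ℕ) : ℝ) * mR) := by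
  intro b hb hcross
  have hRb := hR b hb hcross
  rw [centralBond_eq_b0 (blockOf b.src) b.dir] at hRb ⊢
  have key := dist1_centralDisc_le_stage ℰ hj wt lift g g₀ U U₁ hwt hlift hT4 hT4' hT5 hT5' hcomm ⟨blockOf b.src, b.dir⟩
  refine key.trans (add_le_add (hκrel b hb hcross) ?_)
  have h1 : 0 ≤ dist1 (corr ℰ (GaugeField.gaugeAct (g₀ j) (Averaging.iter (fun i => blockAvg (P := P) (j := i) ℰ) j U₁)) ⟨blockOf b.src, b.dir⟩) :=
    GaugeGroup.dist1_nonneg _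
  have h2 : 0 ≤ (((P.L - 1) / 2 + 1 : ℕ) : ℝ) := by positivity
  have h3 := hκabs b hb hcross
  have h4 : (((P.L - 1) / 2 + 1 : ℕ) : ℝ) *
      dist1 (lift j (GaugeField.gaugeAct (g (j + 1)) (Averaging.iter (fun i => blockAvg (P := P) (j := i) ℰ) (j + 1) U)) (b0 ⟨blockOf b.src, b.dir⟩) *
        (lift j (GaugeField.gaugeAct (g₀ (j + 1)) (Averaging.iter (fun i => blockAvg (P := P) (j := i) ℰ) (j + 1) U₁)) (b0 ⟨blockOf b.src, b.dir⟩))⁻¹) ≤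
      (((P.L - 1) / 2 + 1 : ℕ) : ℝ) * mR := mul_le_mul_of_nonneg_left hRb h2
  have h5 : 0 ≤ (((P.L - 1) / 2 + 1 : ℕ) : ℝ) * mR := mul_nonneg h2 hmR
  calc 2 * dist1 (corr ℰ (GaugeField.gaugeAct (g₀ j) (Averaging.iter (fun i => blockAvg (P := P) (j := i) ℰ) j U₁)) ⟨blockOf b.src, b.dir⟩) *
        ((((P.L - 1) / 2 + 1 : ℕ) : ℝ) *
          dist1 (lift j (GaugeField.gaugeAct (g (j + 1)) (Averaging.iter (fun i => blockAvg (P := P) (j := i) ℰ) (j + 1) U)) (b0 ⟨blockOf b.src, b.dir⟩) *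
            (lift j (GaugeField.gaugeAct (g₀ (j + 1)) (Averaging.iter (fun i => blockAvg (P := P) (j := i) ℰ) (j + 1) U₁)) (b0 ⟨blockOf b.src, b.dir⟩))⁻¹))
      ≤ 2 * dist1 (corr ℰ (GaugeField.gaugeAct (g₀ j) (Averaging.iter (fun i => blockAvg (P := P) (j := i) ℰ) j U₁)) ⟨blockOf b.src, b.dir⟩) *
          ((((P.L - 1) / 2 + 1 : ℕ) : ℝ) * mR) := mul_le_mul_of_nonneg_left h4 (by positivity)
    _ ≤ 2 * aκ * ((((P.L - 1) / 2 + 1 : ℕ) : ℝ) * mR) := by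
        have := mul_le_mul_of_nonneg_right h3 h5
        linarith

end Summit.QuantumFields.YangMills.Theorems.FluctuationComparisonRegPrIntLS2BetaCentralFaceDiscrepancyDock
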